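import Summits.BirchSwinnertonDyer.Rank1Residual.Additive.TameBranchOfHeckeSymbol
import Summits.BirchSwinnertonDyer.Rank1Residual.Additive.TameBranchTeichmuller
import Literature.NumberTheory.EllipticCurves.PAdicLFunctionDistributionHoldsProofs
import Literature.NumberTheory.EllipticCurves.PAdicBSDSplitMultiplicativeProofs
import Literature.NumberTheory.EllipticCurves.PAdicLFunctionMinus
import Mathlib.NumberTheory.LegendreSymbol.QuadraticChar.Basic
import HarnessLib

/-!
# Class N10, defect 2 ((M) ∪ (G-ord, `e = 2`)): E3 TWIST TRANSPORT at the Λ-level — the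
# E-normalised tame branch of the additive curve DELIVERED by the Mazur–Tate–Teitelbaum measure of
# its semistable twist `E♭`, for THE unit `α = unitRoot E♭ p` / `a_p(E♭)`, modulo ONE typed
# comparison statement (the Legendre twist relation of modular symbols)
# (cell `b2b-bsdres`, lane CLASS-CLOSURE, seat cc-typer-2 GEN 3; CLASS-CLOSURE-PLAN §3.2 E3 "(M):
# twist of a multiplicative curve … (G-ord): twist of a good-ordinary curve"; N10/TRANSPORT-TEMPLATE R2)

HONEST FRAMING (cell `b2b-bsdres`, run/shared/lean/b2b/bsd-rank1-residual/, verbatim in every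
file): the goal of the cell is to DELETE the COMBINATION-SHAPED residual classes of the
Birch–Swinnerton-Dyer formula for ALL analytic-rank `≤ 1` elliptic curves over `ℚ` — "full BSD
formula for every rank `≤ 1` curve in class `C`" assembled STRICTLY from published theorems — so
that the rank-`≤ 1` remainder becomes exactly the CONSTRUCTION-SHAPED classes, which are TYPED
(missing-input `Prop`s), NOT attempted. This is not "finishing BSD". Lane CLASS-CLOSURE
(coordinator ruling 2026-08-21T04:07Z): research routes, no claim beyond the stated classes;
census output = EVIDENCE / conjecture items with held-out validation, NEVER a Literature fact;
the class N10 stays CONSTRUCTION-shaped (RESIDUAL-MAP §I); NOTHING is booked. One auxiliary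
definition (the Legendre character with values in `ℚ_p`), TWO typed comparison predicates (the
Legendre twist relation of plus / minus symbols — the cell's own statement of a classical identity,
NOT a Literature fact and NOT asserted), bookkeeping theorems; no named fact, no conjecture node;
labels / RESIDUAL-MAP marks UNCHANGED.

## What and why (E3 = TRANSPORT SEARCH, quadratic twist; deliverable "transport lemma stated with
## the exact comparison statement it needs")

On N10's defect-2 loci the additive curve is `E = E♭ ⊗ χ_{p*}` with `E♭` MULTIPLICATIVE ((M),
Kodaira `I_n*`) or GOOD ORDINARY ((G-ord, `e = 2`), `I₀*`) at the odd prime `p`, and the tame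
character of `TameBranchLower.lean` is the Legendre character `χ_p = (·/p)` (`legendreChar`, §1,
order `2 = tameDefect E p`). The typed main conjecture `TameBranchRatCharEqAt W p` quantifies over
tuples `(f, ε, α, B)` with `IsTameBranchOf f p ε α B`; on the corner cell X4-3 (`e ∈ {3,4,6}`) the
tuple is delivered by the census input (`TameBranchTeichmuller.lean`). THIS FILE delivers it on
DEFECT 2 from the CLASSICAL theory of the twist curve: by `TameBranchOfHeckeSymbol.lean` (the
`p`-stabilised symbol of a Hecke-eigen lattice-valued symbol is an ordinary twist partner) applied to
`S = c·[·]⁺_{f♭}` (even branch, `p ≡ 1 (mod 4)`) resp. `S = c·[·]⁻_{f♭}` (odd branch), whose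
inputs are TREE THEOREMS — the Hecke relations `intCast_mul_ratPlusSymbol` (`T_p`, `p ∤ N♭`) /
`intCast_mul_ratPlusSymbol_of_dvd` (`U_p`, `p ∣ N♭`) and their minus twins, Manin–Drinfeld bounded
denominators `exists_forall_ratPlusSymbol_eq_div_of_maninDrinfeld`, the unit root
`unitRoot_coe_spec`, `1`-periodicity — EXCEPT ONE: the symbol-level twist identity
`[s]⁺_{f_E} = c·∑_{u mod p} (u/p)·[s + u/p]^±_{f♭}` (§2, `LegendreTwistPlusRel` /
`LegendreTwistMinusRel`), the modular-symbol form of `f_E = τ(χ̄)⁻¹∑_u χ̄(u) f♭(· + u/p)`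
(Shimura 1971 Prop. 3.64 / Atkin–Li 1978 §3; in the tree at the level of functions and
`q`-expansions as `coe_charTwist`, `cuspCoeff_charTwist`), which is THE comparison statement of the
transport and enters as an explicit binder (its proof from `coe_charTwist` by integrating along
`{∞ → s}` and dividing by the periods is classical and NOT done here; for the odd branch also the
minus-symbol common denominator `hden` is a binder, the tree having the plus twin only).
RESULTS (this file = even branch): `hasOrdinaryTwistPartner_legendre_of_goodOrd/_of_mult` (the
census-shaped input `CensusX43.HasOrdinaryTwistPartner χ_p f` PRODUCED on defect 2),
`exists_isTameBranchOf_legendre_of_goodOrd` (`α = unitRoot E♭ p`), `…_of_mult` (`α = a_p(E♭) = ±1`);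
the odd-branch (minus-symbol) twins, the `∃!` forms (by `TameBranchUnique.lean`) and the JOIN with
the typed main conjecture are in the companion `TameBranchOfSemistableTwistJoin.lean`. So modulo `LegendreTwist±Rel` the E-intrinsic tame branch of
N10 on defect 2 IS (a rational constant times) the `χ_p`-twisted MTT measure of `E♭` — the object
of the tree's E♭-currency files (`ChiBranchInput`, `padicLFunctionBranch f♭ α (p/2)`,
`X3BranchLambda`, `CensusX41/X42`); the dictionary between the two currencies at the level of
power series (`B = c·ϖ⁻¹·L_p(f♭, α, ω^{(p−1)/2}, T)`) needs the wild-character interpolation of the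
branch, which the tree has only at `T = 0` (`constantCoeff_padicLFunctionBranch_eq`) — not claimed.
Nothing booked; N10 CONSTRUCTION / marks unchanged.

References: Mazur–Tate–Teitelbaum, Invent. Math. 84 (1986) §I.4 (4.2), §I.8, §I.10 (10.1)–(10.2),
§I.11–I.14 [MazurTateTeitelbaum1986Invent]; Shimura 1971 Prop. 3.64 [Shimura1971]; Atkin–Li,
Invent. Math. 48 (1978) §3 [AtkinLi1978]; Delbourgo, Compositio 113 (1998) §1.5, hypothesis (M)
p. 133 [Delbourgo1998]; Pal, *Periods of quadratic twists of elliptic curves*, Proc. AMS 140 (2012)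
[Pal2012]; HOME/class-closure/N10/TRANSPORT-TEMPLATE.md R2; HOME/cells/n1011/ROUTE-2.md §II.
-/

noncomputable section

open scoped Classical MatrixGroups ModularForm

open CongruenceSubgroup

namespace Summit.BirchSwinnertonDyer.Rank1Residual.Additive

open Literature.NumberTheory.EllipticCurves Literature.NumberTheory.EllipticCurves.ModularForms
  Literature.NumberTheory.EllipticCurves.Rank1Residual WeierstrassCurve


/-! ### §1 The Legendre character with values in `ℚ_p` -/

section Legendre

variable (p : ℕ) [hp : Fact p.Prime]

/-- **The Legendre character `(·/p)` as a multiplicative character of `ℤ/p` with values in `ℚ_p`**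
(`quadraticChar (ℤ/p)` pushed along `ℤ → ℚ_p`): the TAME CHARACTER of defect `2`
(`ε = χ_{p*} = ω^{(p−1)/2}`; Delbourgo 1998 hypothesis (M) p. 133 and the case `d = 2` of §1.5).
Data; nothing asserted. [cite: Delbourgo1998, §1.5 and hypothesis (M) (p. 133)] -/
def legendreChar : MulChar (ZMod p) ℚ_[p] :=
  (quadraticChar (ZMod p)).ringHomComp (Int.castRingHom ℚ_[p])

/-- The values of `legendreChar p` are the Legendre symbols `(a/p)`. [folklore] -/
theorem legendreChar_apply (a : ZMod p) :
    legendreChar p a = ((legendreSym p (a.val : ℤ) : ℤ) : ℚ_[p]) := by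
  rw [legendreChar, MulChar.ringHomComp_apply, legendreSym, Int.cast_natCast, ZMod.natCast_zmod_val]
  rfl

/-- `legendreChar p` is quadratic, hence its own inverse. [folklore] -/
theorem legendreChar_inv : (legendreChar p)⁻¹ = legendreChar p :=
  ((quadraticChar_isQuadratic (ZMod p)).comp _).inv

/-- For odd `p` the Legendre character is non-trivial. [folklore] -/
theorem legendreChar_ne_one (hp2 : p ≠ 2) : legendreChar p ≠ 1 :=
  (MulChar.ringHomComp_ne_one_iff Int.cast_injective).mpr
    (quadraticChar_ne_one (by rwa [ZMod.ringChar_zmod_n]))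

/-- For odd `p` the Legendre character has order `2`. [folklore] -/
theorem orderOf_legendreChar (hp2 : p ≠ 2) : orderOf (legendreChar p) = 2 := by
  refine orderOf_eq_prime ?_ (legendreChar_ne_one p hp2)
  rw [pow_two, ← inv_eq_iff_mul_eq_one, legendreChar_inv]

/-- Read in `ℂ_p`, the Legendre character still has order `2` — the binder
`orderOf ε = tameDefect W p` of `TameBranchRatCharEqAt` on defect `2`. [folklore] -/
theorem orderOf_legendreChar_ringHomComp (hp2 : p ≠ 2) :
    orderOf ((legendreChar p).ringHomComp (algebraMap ℚ_[p] ℂ_[p])) = 2 := by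
  rw [orderOf_ringHomComp_padicComplex, orderOf_legendreChar p hp2]

end Legendre

/-! ### §2 THE comparison statement of the twist transport: the Legendre twist relation of symbols -/

section Relation

variable (p : ℕ) [hp : Fact p.Prime] {N N' : ℕ}

/-- **The LEGENDRE TWIST RELATION of plus symbols — the comparison statement of the Λ-level twist
transport on defect `2`, TYPED** (even branch: the partner symbol is the PLUS symbol of `g`). For
weight-`2` cusp forms `f` (level `N`) and `g` (level `N'`) and `c ∈ ℚ`:
`[s]⁺_f = c · ∑_{u mod p} (u/p) · [s + u/p]⁺_g` for every `s ∈ ℚ` (`[·]⁺ = ratPlusSymbol`, each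
normalised by its own `Ω⁺`). MEANING: for `E = E♭ ⊗ χ_{p*}` additive of defect `2` at `p`,
`f = f_E`, `g = f_{E♭}` and `p* = p ≡ 1 (mod 4)` (`χ_p` even) this is the modular-symbol form of
the twisting identity `f_E = τ(χ_p)⁻¹ ∑_{u mod p} χ_p(u) f_{E♭}(· + u/p)` (Shimura 1971 Prop. 3.64,
Atkin–Li 1978 §3; the tree's `coe_charTwist` / `cuspCoeff_charTwist` give it at the level of
functions and `q`-expansions) integrated along `{∞ → s}`, with `c = Ω⁺_{f_{E♭}}/(τ(χ_p)·Ω⁺_{f_E}) ∈ ℚ`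
(a ratio of two rationals as soon as one twisted sum is non-zero; cf. Pal 2012 for the periods). At
`s = 0` it reads `[0]⁺_{f_E} = c · ∑_a (a/p)[a/p]⁺_{f_{E♭}}` (`legendrePlusSymbolSum`, the currency of
`ChiBranchLeadingTermAt`). STATUS: a predicate — the ONE classical input of the transport, provable
in the tree from `coe_charTwist` + linearity of `modularSymbol` + `q`-expansion injectivity; NOT
proved in this file, where it enters as an explicit binder. Nothing asserted.
[cite: Shimura1971, Prop. 3.64 (shape only; nothing asserted)]
[cite: MazurTateTeitelbaum1986Invent, §I.8 (twisted modular symbols; shape)] -/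
def LegendreTwistPlusRel (f : CuspForm (Gamma0 N) 2) (g : CuspForm (Gamma0 N') 2) (c : ℚ) : Prop :=
  ∀ s : ℚ, ratPlusSymbol f s =
    c * ∑ u : ZMod p, (legendreSym p (u.val : ℤ) : ℚ) * ratPlusSymbol g (s + (u.val : ℚ) / p)

/-- **The LEGENDRE TWIST RELATION, odd branch** (`p* = −p`, `p ≡ 3 (mod 4)`, `χ_p` odd: the twist
swaps real and imaginary parts, so the partner symbol is the MINUS symbol `[·]⁻_g = ratMinusSymbol g`,
normalised by `Ω⁻_g`): `[s]⁺_f = c · ∑_{u mod p} (u/p) · [s + u/p]⁻_g` for every `s`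
(`c = ±Ω⁻_{f_{E♭}}/(√p·Ω⁺_{f_E})`). Same status as `LegendreTwistPlusRel`; nothing asserted.
[cite: Shimura1971, Prop. 3.64 (shape only; nothing asserted)]
[cite: MazurTateTeitelbaum1986Invent, §I.8 (twisted modular symbols; shape)] -/
def LegendreTwistMinusRel (f : CuspForm (Gamma0 N) 2) (g : CuspForm (Gamma0 N') 2) (c : ℚ) :
    Prop :=
  ∀ s : ℚ, ratPlusSymbol f s =
    c * ∑ u : ZMod p, (legendreSym p (u.val : ℤ) : ℚ) * ratMinusSymbol g (s + (u.val : ℚ) / p)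

variable {p}

/-- The plus relation in `ℚ_p`-currency: `[·]⁺_f = τ_{χ_p⁻¹} S` with `S = c·[·]⁺_g`. [folklore] -/
theorem LegendreTwistPlusRel.cast_eq_twist {f : CuspForm (Gamma0 N) 2} {g : CuspForm (Gamma0 N') 2}
    {c : ℚ} (h : LegendreTwistPlusRel p f g c) (s : ℚ) :
    ((ratPlusSymbol f s : ℚ) : ℚ_[p]) =
      CensusX43.twist (legendreChar p)⁻¹ (fun r ↦ (c : ℚ_[p]) * ((ratPlusSymbol g r : ℚ) : ℚ_[p])) s := by
  rw [h s, legendreChar_inv, CensusX43.twist]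
  push_cast
  rw [Finset.mul_sum]
  refine Finset.sum_congr rfl fun u _ ↦ ?_
  rw [legendreChar_apply]
  ring

/-- The minus relation in `ℚ_p`-currency: `[·]⁺_f = τ_{χ_p⁻¹} S` with `S = c·[·]⁻_g`. [folklore] -/
theorem LegendreTwistMinusRel.cast_eq_twist {f : CuspForm (Gamma0 N) 2} {g : CuspForm (Gamma0 N') 2}
    {c : ℚ} (h : LegendreTwistMinusRel p f g c) (s : ℚ) :
    ((ratPlusSymbol f s : ℚ) : ℚ_[p]) =
      CensusX43.twist (legendreChar p)⁻¹ (fun r ↦ (c : ℚ_[p]) * ((ratMinusSymbol g r : ℚ) : ℚ_[p])) s := by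
  rw [h s, legendreChar_inv, CensusX43.twist]
  push_cast
  rw [Finset.mul_sum]
  refine Finset.sum_congr rfl fun u _ ↦ ?_
  rw [legendreChar_apply]
  ring

end Relation

/-! ### §3 Lattice-valued rational symbols, in `ℚ_p` -/

section Lattice

variable {p : ℕ} [hp : Fact p.Prime]

/-- A `ℚ`-valued function with ONE common denominator, times a rational constant, is
`c'·ℤ_p`-valued in `ℚ_p` (`c' = c/D`). [folklore] -/
theorem exists_forall_eq_mul_padicInt_of_eq_div {T : ℚ → ℚ} {D : ℕ} (hD : 0 < D)
    (hT : ∀ r, ∃ m : ℤ, T r = (m : ℚ) / D) (c : ℚ) :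
    ∃ c' : ℚ_[p], ∀ s, ∃ z : ℤ_[p], (c : ℚ_[p]) * ((T s : ℚ) : ℚ_[p]) = c' * z := by
  refine ⟨(c : ℚ_[p]) / (D : ℚ_[p]), fun s ↦ ?_⟩
  obtain ⟨m, hm⟩ := hT s
  refine ⟨(m : ℤ_[p]), ?_⟩
  have hD0 : (D : ℚ_[p]) ≠ 0 := Nat.cast_ne_zero.mpr hD.ne'
  rw [hm, PadicInt.coe_intCast]
  push_cast
  field_simp

end Lattice

/-! ### §4 Defect 2, (G-ord, `e = 2`): the twist of a GOOD ORDINARY curve — `α = unitRoot E♭ p` -/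

section GoodOrdinary

variable {p : ℕ} [hp : Fact p.Prime] {N N' : ℕ} [NeZero N'] {f : CuspForm (Gamma0 N) 2}
  {g : CuspForm (Gamma0 N') 2} (V : WeierstrassCurve ℚ) [V.IsElliptic] [V.IsGloballyMinimal]

/-- **(G-ord, `e = 2`), even branch: the census input `HasOrdinaryTwistPartner χ_p f` PRODUCED from
the good ordinary twist curve.** Let `V` (`E♭`) be globally minimal, GOOD ORDINARY at the odd prime
`p`, with newform `g`; let `f` be any weight-`2` cusp form whose plus symbols satisfy the Legendre
twist relation `LegendreTwistPlusRel p f g c` (for `f = f_E`, `E = V ⊗ χ_p`, `p ≡ 1 (mod 4)`: the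
comparison statement of §2). Then `[·]⁺_f` has an ordinary twist partner for `χ_p`: the
`p`-stabilised symbol `c·([s]⁺_g − α⁻¹[ps]⁺_g)`, `α = unitRoot V p`. Inputs from the tree (all
THEOREMS): the Hecke relation `a_p[r]⁺ = ∑_j[(r+j)/p]⁺ + [pr]⁺` (`intCast_mul_ratPlusSymbol`, MTT
(4.2)), Manin–Drinfeld bounded denominators (`exists_forall_ratPlusSymbol_eq_div_of_maninDrinfeld`),
the unit root (`unitRoot_coe_spec`, Hensel), `1`-periodicity. [cite: MazurTateTeitelbaum1986Invent, §I.4 (4.2) and §I.10 (10.1)–(10.2)] -/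
theorem hasOrdinaryTwistPartner_legendre_of_goodOrd (hp2 : p ≠ 2) (hord : IsOrdinaryAt V p)
    (hg : IsNewformOf V g) {c : ℚ} (hrel : LegendreTwistPlusRel p f g c) :
    CensusX43.HasOrdinaryTwistPartner (legendreChar p) f := by
  haveI : NeZero p := ⟨hp.out.ne_zero⟩
  have hMD := exists_nsmul_modularSymbol_mem_periodLattice_of_isNewformOf hg
  have hrat := ratCast_ratPlusSymbol_of_maninDrinfeld hMD
  obtain ⟨D, hD, hden⟩ := exists_forall_ratPlusSymbol_eq_div_of_maninDrinfeld hMD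
  obtain ⟨c', hlat⟩ := exists_forall_eq_mul_padicInt_of_eq_div (p := p) hD hden c
  obtain ⟨hαeq, hαu, -⟩ := unitRoot_coe_spec (W := V) hord
  have hpN : ¬ p ∣ N' := not_dvd_level_of_isNewformOf hg hord.1
  have hap := cuspCoeff_eq_frobeniusTrace_of_isNewformOf_holds hg hord.1
  refine hasOrdinaryTwistPartner_of_heckeSymbol (S := fun r ↦ (c : ℚ_[p]) * ((ratPlusSymbol g r : ℚ) : ℚ_[p]))
    (ap := ((V.frobeniusTrace p : ℤ) : ℚ_[p])) (α := (unitRoot V p : ℚ_[p])) (δ := 1) (c := c')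
    (legendreChar_ne_one p hp2) (fun s ↦ ?_) hrel.cast_eq_twist (fun r ↦ ?_) ?_ hαu
    (by rw [norm_one]) hlat
  · -- periodicity
    rw [show (s + 1 : ℚ) = s + ((1 : ℤ) : ℚ) by push_cast; rfl, ratPlusSymbol_add_intCast_eq]
  · -- the Hecke relation `T_p`, cast to `ℚ_p` and scaled by `c`
    have h := intCast_mul_ratPlusSymbol p hg.1 hp.out hpN hap hrat r
    have h' := congrArg (fun q : ℚ ↦ (c : ℚ_[p]) * (q : ℚ_[p])) h
    push_cast at h'
    rw [mul_add, Finset.mul_sum] at h'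
    linear_combination h'
  · rw [one_mul]; exact hαeq

/-- **(G-ord, `e = 2`), even branch: the E-normalised tame branch FROM THE TWIST CURVE's measure,
for THE unit root `α = unitRoot E♭ p`.** Under the hypotheses of
`hasOrdinaryTwistPartner_legendre_of_goodOrd`: `∃ B, IsTameBranchOf f p (ι∘χ_p) (unitRoot V p) B`
— the Mellin transform of `χ_p·μ_Φ`, `Φ` the `p`-stabilised symbol of `c·[·]⁺_g`, i.e. up to the
constant `c` the `χ_p`-twisted Mazur–Tate–Teitelbaum measure of `E♭` — with the integrality
transfer from the plus symbols of `f`. So on (G-ord, `e = 2`) rows the premise of the typed main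
conjecture `TameBranchRatCharEqAt W p` is inhabited by an object of `E♭`'s classical theory, MODULO
the comparison statement `LegendreTwistPlusRel` (E3 twist transport, Λ-level). Nothing booked.
[cite: MazurTateTeitelbaum1986Invent, §I.10 (10.1)–(10.2) and §I.14 (14.3)] -/
theorem exists_isTameBranchOf_legendre_of_goodOrd (hp2 : p ≠ 2) (hord : IsOrdinaryAt V p)
    (hg : IsNewformOf V g) {c : ℚ} (hrel : LegendreTwistPlusRel p f g c) :
    ∃ B : PowerSeries ℚ_[p],
      IsTameBranchOf f p ((legendreChar p).ringHomComp (algebraMap ℚ_[p] ℂ_[p]))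
        (unitRoot V p : ℚ_[p]) B ∧
      ∀ C : ℝ, (∀ r : ℚ, ‖((ratPlusSymbol f r : ℚ) : ℚ_[p])‖ ≤ C) →
        ∀ n : ℕ, ‖PowerSeries.coeff n B‖ ≤ C := by
  haveI : NeZero p := ⟨hp.out.ne_zero⟩
  have hMD := exists_nsmul_modularSymbol_mem_periodLattice_of_isNewformOf hg
  have hrat := ratCast_ratPlusSymbol_of_maninDrinfeld hMD
  obtain ⟨D, hD, hden⟩ := exists_forall_ratPlusSymbol_eq_div_of_maninDrinfeld hMD
  obtain ⟨c', hlat⟩ := exists_forall_eq_mul_padicInt_of_eq_div (p := p) hD hden c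
  obtain ⟨hαeq, hαu, -⟩ := unitRoot_coe_spec (W := V) hord
  have hpN : ¬ p ∣ N' := not_dvd_level_of_isNewformOf hg hord.1
  have hap := cuspCoeff_eq_frobeniusTrace_of_isNewformOf_holds hg hord.1
  refine exists_isTameBranchOf_of_heckeSymbol (S := fun r ↦ (c : ℚ_[p]) * ((ratPlusSymbol g r : ℚ) : ℚ_[p]))
    (ap := ((V.frobeniusTrace p : ℤ) : ℚ_[p])) (δ := 1) (c := c')
    (legendreChar_ne_one p hp2) (fun s ↦ ?_) hrel.cast_eq_twist (fun r ↦ ?_) ?_ hαu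
    (by rw [norm_one]) hlat
  · rw [show (s + 1 : ℚ) = s + ((1 : ℤ) : ℚ) by push_cast; rfl, ratPlusSymbol_add_intCast_eq]
  · have h := intCast_mul_ratPlusSymbol p hg.1 hp.out hpN hap hrat r
    have h' := congrArg (fun q : ℚ ↦ (c : ℚ_[p]) * (q : ℚ_[p])) h
    push_cast at h'
    rw [mul_add, Finset.mul_sum] at h'
    linear_combination h'
  · rw [one_mul]; exact hαeq

end GoodOrdinary

/-! ### §5 Defect 2, (M): the twist of a MULTIPLICATIVE curve — `α = a_p(E♭) = ±1` -/

section Multiplicative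

variable {p : ℕ} [hp : Fact p.Prime] {N N' : ℕ} [NeZero N'] {f : CuspForm (Gamma0 N) 2}
  {g : CuspForm (Gamma0 N') 2}

/-- **(M), even branch: the census-shaped input `HasOrdinaryTwistPartner χ_p f` PRODUCED from the
multiplicative twist.** Let `g` be a normalised newform of level `N'` with rational coefficients,
`p ∣ N'` (exactly once in the application: `g = f_{E♭}`, `E♭` multiplicative at `p`) and
`a_p(g) = ±1`; let `f` satisfy `LegendreTwistPlusRel p f g c`. Then `[·]⁺_f` has an ordinary twist
partner for `χ_p` with eigenvalue `a_p(g)`: the symbol `c·[·]⁺_g` itself (`δ = 0`: no stabilisation;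
`U_p g = a_p g`, tree `intCast_mul_ratPlusSymbol_of_dvd`). [cite: MazurTateTeitelbaum1986Invent, §I.4 and §I.10 (10.1) with ε(p) = 0] -/
theorem hasOrdinaryTwistPartner_legendre_of_mult (hp2 : p ≠ 2) (hg : IsNewform0 g)
    (hQ : coeffField g = ⊥) (hpN : p ∣ N') {ap : ℤ} (hap : cuspCoeff g p = ap)
    (hap1 : ap = 1 ∨ ap = -1) {c : ℚ} (hrel : LegendreTwistPlusRel p f g c) :
    CensusX43.HasOrdinaryTwistPartner (legendreChar p) f := by
  haveI : NeZero p := ⟨hp.out.ne_zero⟩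
  have hMD := exists_nsmul_modularSymbol_mem_periodLattice_of_isNewform0 hg hQ
  have hrat := ratCast_ratPlusSymbol_of_maninDrinfeld hMD
  obtain ⟨D, hD, hden⟩ := exists_forall_ratPlusSymbol_eq_div_of_maninDrinfeld hMD
  obtain ⟨c', hlat⟩ := exists_forall_eq_mul_padicInt_of_eq_div (p := p) hD hden c
  have hαu : ‖((ap : ℤ) : ℚ_[p])‖ = 1 := by
    rcases hap1 with h | h <;> simp [h]
  refine hasOrdinaryTwistPartner_of_heckeSymbol (S := fun r ↦ (c : ℚ_[p]) * ((ratPlusSymbol g r : ℚ) : ℚ_[p]))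
    (ap := ((ap : ℤ) : ℚ_[p])) (α := ((ap : ℤ) : ℚ_[p])) (δ := 0) (c := c')
    (legendreChar_ne_one p hp2) (fun s ↦ ?_) hrel.cast_eq_twist (fun r ↦ ?_) (by ring) hαu
    (by rw [norm_zero]; exact zero_le_one) hlat
  · rw [show (s + 1 : ℚ) = s + ((1 : ℤ) : ℚ) by push_cast; rfl, ratPlusSymbol_add_intCast_eq]
  · have h := intCast_mul_ratPlusSymbol_of_dvd p hg hp.out hpN hap hrat r
    have h' := congrArg (fun q : ℚ ↦ (c : ℚ_[p]) * (q : ℚ_[p])) h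
    push_cast at h'
    rw [Finset.mul_sum] at h'
    linear_combination h'

/-- **(M), even branch: the E-normalised tame branch from the multiplicative twist, for THE unit
`α = a_p(E♭) = ±1`.** Under the hypotheses of `hasOrdinaryTwistPartner_legendre_of_mult`:
`∃ B, IsTameBranchOf f p (ι∘χ_p) (a_p(g)) B` with the integrality transfer. So on (M) rows the
premise of `TameBranchRatCharEqAt W p` is inhabited by (a constant times) the `χ_p`-twisted
one-term measure of `E♭` (`msdPlusMeasureMult`), MODULO `LegendreTwistPlusRel`. Nothing booked.
[cite: MazurTateTeitelbaum1986Invent, §I.10 (10.1) with ε(p) = 0 and §I.14 (14.3)]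
[cite: Delbourgo1998, hypothesis (M) (p. 133)] -/
theorem exists_isTameBranchOf_legendre_of_mult (hp2 : p ≠ 2) (hg : IsNewform0 g)
    (hQ : coeffField g = ⊥) (hpN : p ∣ N') {ap : ℤ} (hap : cuspCoeff g p = ap)
    (hap1 : ap = 1 ∨ ap = -1) {c : ℚ} (hrel : LegendreTwistPlusRel p f g c) :
    ∃ B : PowerSeries ℚ_[p],
      IsTameBranchOf f p ((legendreChar p).ringHomComp (algebraMap ℚ_[p] ℂ_[p]))
        ((ap : ℤ) : ℚ_[p]) B ∧
      ∀ C : ℝ, (∀ r : ℚ, ‖((ratPlusSymbol f r : ℚ) : ℚ_[p])‖ ≤ C) →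
        ∀ n : ℕ, ‖PowerSeries.coeff n B‖ ≤ C := by
  haveI : NeZero p := ⟨hp.out.ne_zero⟩
  have hMD := exists_nsmul_modularSymbol_mem_periodLattice_of_isNewform0 hg hQ
  have hrat := ratCast_ratPlusSymbol_of_maninDrinfeld hMD
  obtain ⟨D, hD, hden⟩ := exists_forall_ratPlusSymbol_eq_div_of_maninDrinfeld hMD
  obtain ⟨c', hlat⟩ := exists_forall_eq_mul_padicInt_of_eq_div (p := p) hD hden c
  have hαu : ‖((ap : ℤ) : ℚ_[p])‖ = 1 := by
    rcases hap1 with h | h <;> simp [h]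
  refine exists_isTameBranchOf_of_heckeSymbol (S := fun r ↦ (c : ℚ_[p]) * ((ratPlusSymbol g r : ℚ) : ℚ_[p]))
    (ap := ((ap : ℤ) : ℚ_[p])) (δ := 0) (c := c')
    (legendreChar_ne_one p hp2) (fun s ↦ ?_) hrel.cast_eq_twist (fun r ↦ ?_) (by ring) hαu
    (by rw [norm_zero]; exact zero_le_one) hlat
  · rw [show (s + 1 : ℚ) = s + ((1 : ℤ) : ℚ) by push_cast; rfl, ratPlusSymbol_add_intCast_eq]
  · have h := intCast_mul_ratPlusSymbol_of_dvd p hg hp.out hpN hap hrat r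
    have h' := congrArg (fun q : ℚ ↦ (c : ℚ_[p]) * (q : ℚ_[p])) h
    push_cast at h'
    rw [Finset.mul_sum] at h'
    linear_combination h'

end Multiplicative

end Summit.BirchSwinnertonDyer.Rank1Residual.Additive

end
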